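import Mathlib
import HarnessLib

/-!
# Vocabulary of line `cofactor-root-discrepancy` (crux `SplitBlockJacobi`, stmt-Parity-11583):
# definitions only, verbatim from the registered skeleton

The concrete finite sums through which the line's stubs are stated: the small-root count
`rootCount q x = A_q(x)`, its discrepancy `disc`, the free pair set `pairs θ x`, the bulk discrepancy
`Dbulk θ μ x`, the root Weyl sum `rootWeylSum h q = S(h, q)`, the twisted root Weyl sum
`twistedSum h P₁ P₁' P₂ P₂'` over a box of primes `≡ 1 (mod 4)`, and the line's HYPOTHESIS
`TierWeylBound θ μ` (an open bilinear estimate; it is the hypothesis of `stub_poissonReduction` and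
the conclusion of `stub_weylShallow` / `stub_weylDeep`).  Only the definitional unfolding `dbulk_eq_sum` is stated; the bodies are
copied verbatim from the skeleton `Lines/cofactor-root-discrepancy.lean` so that the stubs can land
def-free against these names.
-/

noncomputable section

open Finset Filter

namespace Summit.Parity.BatemanHorn.Cruxes.SplitBlockJacobi.CofactorRootDiscrepancy

/-- `A_q(x) = #{1 ≤ t ≤ x : q ∣ t²+1}` — the number of SMALL roots of `-1` modulo `q`
(for `q > x`: at most one period, so `A_q(x) ≤ ρ(q)`, `= 4` for `q = QQ′` a product of two
distinct primes `≡ 1 (mod 4)`). Verbatim from the line skeleton. -/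
def rootCount (q x : ℕ) : ℕ := ((Finset.Icc 1 x).filter (fun t : ℕ => q ∣ t ^ 2 + 1)).card

/-- The root DISCREPANCY `disc_q(x) := A_q(x) − 4x/q` (expected count `x·ρ(q)/q`, `ρ(QQ′) = 4`).
Verbatim from the line skeleton. -/
def disc (q x : ℕ) : ℝ := (rootCount q x : ℝ) - 4 * (x : ℝ) / (q : ℝ)

/-- The FREE pair set `P_θ(x)`: prime pairs `Q ≡ Q′ ≡ 1 (mod 4)`, `x^θ < Q < Q′`, `QQ′ ≤ x²+1`
(both coordinates `< x²+2`, so a genuine `Finset`). Verbatim from the line skeleton. -/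
def pairs (θ : ℝ) (x : ℕ) : Finset (ℕ × ℕ) :=
  (Finset.range (x ^ 2 + 2) ×ˢ Finset.range (x ^ 2 + 2)).filter (fun q : ℕ × ℕ =>
    q.1.Prime ∧ q.2.Prime ∧ q.1 % 4 = 1 ∧ q.2 % 4 = 1 ∧ (x : ℝ) ^ θ < (q.1 : ℝ) ∧ q.1 < q.2 ∧
      q.1 * q.2 ≤ x ^ 2 + 1)

/-- `D^{bulk}_{θ,μ}(x) := Σ_{(Q,Q′) ∈ P_θ(x), QQ′ ≤ x^{2−μ}} (Q|Q′) · disc_{QQ′}(x)` — the weighted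
root discrepancy over the BULK (cofactor `m = (t²+1)/(QQ′) ≳ x^μ`). Verbatim from the line
skeleton. -/
def Dbulk (θ μ : ℝ) (x : ℕ) : ℝ :=
  ∑ q ∈ (pairs θ x).filter (fun q : ℕ × ℕ => ((q.1 * q.2 : ℕ) : ℝ) ≤ (x : ℝ) ^ (2 - μ)),
    (jacobiSym (q.1 : ℤ) q.2 : ℝ) * disc (q.1 * q.2) x

/-- The ROOT WEYL SUM `S(h,q) := Σ_{ν mod q, ν² ≡ −1 (q)} e(hν/q)`. Verbatim from the line
skeleton. -/
def rootWeylSum (h : ℤ) (q : ℕ) : ℂ :=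
  ∑ ν ∈ (Finset.range q).filter (fun ν : ℕ => q ∣ ν ^ 2 + 1),
    Complex.exp (2 * Real.pi * Complex.I * (h : ℂ) * (ν : ℂ) / (q : ℂ))

/-- The TWISTED ROOT WEYL SUM over a box of primes `≡ 1 (mod 4)`,
`T_h((P₁,P₁'] × (P₂,P₂']) := Σ_{Q ∈ (P₁,P₁']} Σ_{Q′ ∈ (P₂,P₂']} (Q|Q′) · S(h, QQ′)`
(terms with `Q = Q′` vanish since `(Q|Q) = 0`). Verbatim from the line skeleton. -/
def twistedSum (h : ℤ) (P₁ P₁' P₂ P₂' : ℕ) : ℂ :=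
  ∑ Q ∈ (Finset.Ioc P₁ P₁').filter (fun Q : ℕ => Q.Prime ∧ Q % 4 = 1),
    ∑ Q' ∈ (Finset.Ioc P₂ P₂').filter (fun Q' : ℕ => Q'.Prime ∧ Q' % 4 = 1),
      (jacobiSym (Q : ℤ) Q' : ℂ) * rootWeylSum h (Q * Q')

/-- **`TierWeylBound θ μ` — the line's HYPOTHESIS** (not a cited fact: an OPEN bilinear estimate,
the hypothesis of `stub_poissonReduction` and the conclusion of the open stubs `stub_weylShallow`,
`stub_weylDeep`): for `x ≥ x₀`, every box of dyadic type with `x^θ ≤ 2P₁`, `P₁ ≤ P₂`,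
`P₁P₂ ≤ x^{2−μ}`, every left-anchored sub-interval pair, and every frequency
`0 < |h| ≤ P₁P₂·x^{ε₀−1}`, the twisted root Weyl sum satisfies `|T_h| ≤ x^{1−ε₀}`.
Verbatim from the line skeleton. -/
def TierWeylBound (θ μ : ℝ) : Prop :=
  ∃ ε₀ : ℝ, 0 < ε₀ ∧ ∃ x₀ : ℕ, ∀ x : ℕ, x₀ ≤ x → ∀ P₁ P₁' P₂ P₂' : ℕ,
    (x : ℝ) ^ θ ≤ 2 * (P₁ : ℝ) → P₁ ≤ P₁' → P₁' ≤ 2 * P₁ → P₁ ≤ P₂ → P₂ ≤ P₂' → P₂' ≤ 2 * P₂ →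
      ((P₁ * P₂ : ℕ) : ℝ) ≤ (x : ℝ) ^ (2 - μ) →
        ∀ h : ℤ, h ≠ 0 → (|h| : ℝ) ≤ ((P₁ * P₂ : ℕ) : ℝ) * (x : ℝ) ^ (ε₀ - 1) →
          ‖twistedSum h P₁ P₁' P₂ P₂'‖ ≤ (x : ℝ) ^ (1 - ε₀)

/-- **Unfolding `Dbulk`** (registered stub form): the bulk discrepancy written out as the explicit
finite sum over the bulk pairs of `(Q|Q′)·(A_{QQ′}(x) − 4x/(QQ′))`; definitional. -/
theorem dbulk_eq_sum :
    ∀ (θ μ : ℝ) (x : ℕ), Dbulk θ μ x = ∑ q ∈ ((Finset.range (x ^ 2 + 2) ×ˢ Finset.range (x ^ 2 + 2)).filter (fun q : ℕ × ℕ => q.1.Prime ∧ q.2.Prime ∧ q.1 % 4 = 1 ∧ q.2 % 4 = 1 ∧ (x : ℝ) ^ θ < (q.1 : ℝ) ∧ q.1 < q.2 ∧ q.1 * q.2 ≤ x ^ 2 + 1)).filter (fun q : ℕ × ℕ => ((q.1 * q.2 : ℕ) : ℝ) ≤ (x : ℝ) ^ (2 - μ)), (jacobiSym (q.1 : ℤ)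 q.2 : ℝ) * (((((Finset.Icc 1 x).filter (fun t : ℕ => q.1 * q.2 ∣ t ^ 2 + 1)).card : ℕ) : ℝ) - 4 * (x : ℝ) / ((q.1 * q.2 : ℕ) : ℝ)) :=
  fun _ _ _ => rfl

end Summit.Parity.BatemanHorn.Cruxes.SplitBlockJacobi.CofactorRootDiscrepancy

end
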